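import Literature.NumberTheory.Automorphic.ShellSubgroupGL2
import Literature.NumberTheory.Automorphic.TwistedSubgroupAverage
import Literature.NumberTheory.Automorphic.GLnCuspidalSpectrumProofs
import Literature.NumberTheory.Automorphic.GLnAdelicStructureProofs
import Literature.NumberTheory.Automorphic.GlobalAdditiveCharacter
import Literature.NumberTheory.Automorphic.AddCharConductorExponent
import Literature.NumberTheory.Automorphic.AdelicAdditiveCharacter
import HarnessLib

/-!
# The shell subgroup at a finite place: compactness, the local regular representation, the shell character

Topic `NumberTheory/Automorphic`; namespace `Literature.NumberTheory.Automorphic`. Groundwork for the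
finite-place half of the Kirillov `L²`-bound of the smoothed Whittaker coefficient on `GL_2` (the
`n ≤ 2` case of the named fact `JacquetShalika1981_partialPairL_pole_of_eq_conj`), adelic layer.

At a finite place `v` of the number field `K` let `J_{r,c} ≤ GL_2(K_v)` be the shell subgroup of
`ShellSubgroupGL2` (`c ≥ 1`). This file proves it compact (`isCompact_shellSubgroup`: open — it contains the principal
congruence subgroup `K_v(e^{-N})` — and conjugate into `GL_2(𝒪_v)` by the torus element `a(t)`,
`|t| = e^{r}`), defines the **local right regular representation** `R ∘ ι_v` of `GL_2(K_v)` on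
`L²(GL_2(K) A_G \ GL_2(𝔸_K))` (`localRightRegular`, `ι_v = GLn.toAdelic`) and the **shell character**
`χ_v(j) = ψ_v(j₁₂)` for the component `ψ_v` of Tate's character (`shellChar`), and shows that, as soon
as `ψ_v` is trivial on `𝔭_v^{c-r}`, the triple `(J_{r,c}, R ∘ ι_v, χ_v)` is a twist datum in the
sense of `TwistedSubgroupAverage` (`isTwistData_shell`): `R ∘ ι_v` is unitary and strongly continuous,
`χ_v` is a continuous unitary character of `J_{r,c}` (additivity of `j ↦ j₁₂` modulo `𝔭^{c-r}`,
`valued_mul_entry_sub_le`). Finally the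
**level subgroup** `U ⊓ (K_v(e^{-N}))` of `GL_2(𝔸_K^∞)` (`levelInfAt`) is compact open, and its elements
have `v`-component in `J_{r,c} ∩ ker χ` for `N` large (`toLocal_ofFinite_mem_of_mem_levelAt`).
All proofs complete; no named facts (Bump (1997), §3.3, §4.4).

## References

* D. Bump, *Automorphic Forms and Representations*, CUP (1997), §3.3, §4.4 [Bump1997].
* C. J. Bushnell, G. Henniart, *The local Langlands conjecture for GL(2)*, Springer (2006), §12
  [BushnellHenniart2006].
-/

noncomputable section

open scoped MatrixGroups ComplexConjugate
open Matrix WithZero NumberField IsDedekindDomain MeasureTheory Topology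

namespace Literature.NumberTheory.Automorphic

open ShellGL2

section Place

variable (K : Type) [Field K] [NumberField K] (v : HeightOneSpectrum (𝓞 K))

local notation "𝓋" => (Valued.v : Valuation (v.adicCompletion K) (WithZero (Multiplicative ℤ)))

/-! ### Compactness of the local shell subgroup -/

/-- `K_v(e^{-N}) ≤ J_{r,c}` for `N ≥ max(c + r, c, -r)` (as subgroups of `GL_2(K_v)`). [folklore] -/
theorem localCongruenceSubgroup_le_shellSubgroup {r c : ℤ} (hc : 1 ≤ c) {N : ℕ} (h1 : -(N : ℤ) ≤ r) (h2 : c + r ≤ N)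
    (h3 : c ≤ N) : localCongruenceSubgroup 2 K v N ≤ shellSubgroup (F := v.adicCompletion K) r c hc :=
  fun _ hg => shellCond_of_mem_valuedCongruenceSubgroup h1 h2 h3 hg

/-- The local shell subgroup is open. [folklore] -/
theorem isOpen_shellSubgroup {r c : ℤ} (hc : 1 ≤ c) :
    IsOpen ((shellSubgroup (F := v.adicCompletion K) r c hc : Subgroup (GL (Fin 2) (v.adicCompletion K))) :
      Set (GL (Fin 2) (v.adicCompletion K))) := by
  set N : ℕ := (max (max (c + r) c) (-r)).toNat with hN
  have hN' : max (max (c + r) c) (-r) ≤ (N : ℤ) := Int.self_le_toNat _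
  exact Subgroup.isOpen_mono (localCongruenceSubgroup_le_shellSubgroup K v hc (N := N) (by omega) (by omega) (by omega))
    (isOpen_localCongruenceSubgroup 2 K v N)

/-- Conjugating `J_{r,c}` by `a(t)`, `|t| = e^{r}`, lands in `GL_2(𝒪_v)`. [folklore] -/
theorem aInv_mul_mul_a_mem_valuedCongruenceSubgroup_one {r c : ℤ} (hc : 1 ≤ c) {t : (v.adicCompletion K)ˣ}
    (ht : 𝓋 (t : v.adicCompletion K) = exp r) {g : GL (Fin 2) (v.adicCompletion K)} (hg : ShellCond r c g) :
    (glDiagonal 2 (v.adicCompletion K) ![t, 1])⁻¹ * g * glDiagonal 2 (v.adicCompletion K) ![t, 1] ∈ valuedCongruenceSubgroup (Fin 2) (1 : WithZero (Multiplicative ℤ)) := by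
  obtain ⟨e00, e01, e10, e11⟩ := ent_aInv_mul_mul_a t g
  obtain ⟨h00, h11, h01, h10⟩ := hg
  have hti : 𝓋 (((t⁻¹ : (v.adicCompletion K)ˣ) : v.adicCompletion K)) = exp (-r) := by
    rw [Units.val_inv_eq_inv_val, map_inv₀, ht, WithZero.exp_neg]
  have hcond : ShellCond 0 c ((glDiagonal 2 (v.adicCompletion K) ![t, 1])⁻¹ * g * glDiagonal 2 (v.adicCompletion K) ![t, 1]) := by
    refine ⟨by rw [e00]; exact h00, by rw [e11]; exact h11, ?_, ?_⟩
    · rw [e01, map_mul, hti]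
      calc exp (-r) * 𝓋 (ent g 0 1) ≤ exp (-r) * exp r := mul_le_mul_right h01 _
        _ = exp 0 := by rw [← exp_add]; congr 1; ring
    · rw [e10, map_mul, ht]
      calc 𝓋 (ent g 1 0) * exp r ≤ exp (-c - r) * exp r := mul_le_mul_left h10 _
        _ = exp (-c - 0) := by rw [← exp_add]; congr 1; ring
  have h := shellCond_mem_valuedCongruenceSubgroup (c' := 0) hc le_rfl (by omega) (by omega) le_rfl hcond
  rwa [neg_zero, exp_zero] at h

/-- **The local shell subgroup is compact.** [folklore] -/
theorem isCompact_shellSubgroup {r c : ℤ} (hc : 1 ≤ c) :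
    IsCompact ((shellSubgroup (F := v.adicCompletion K) r c hc : Subgroup (GL (Fin 2) (v.adicCompletion K))) :
      Set (GL (Fin 2) (v.adicCompletion K))) := by
  -- a torus element of valuation `e^{r}`
  obtain ⟨π, hπ0, hπ⟩ := exists_coe_valued_eq_exp_neg_one (K := K) v
  have hπv0 : (π : v.adicCompletion K) ≠ 0 := fun h => by rw [h, map_zero] at hπ; exact exp_ne_zero hπ.symm
  set t : (v.adicCompletion K)ˣ := (Units.mk0 (π : v.adicCompletion K) hπv0) ^ (-r) with ht
  have htv : 𝓋 (t : v.adicCompletion K) = exp r := by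
    rw [ht, Units.val_zpow_eq_zpow_val, Units.val_mk0, map_zpow₀, hπ, ← WithZero.exp_zsmul, smul_eq_mul]; congr 1; ring
  -- `J ⊆ a(t) GL_2(𝒪_v) a(t)⁻¹`, a compact set; `J` is closed
  have hK1 : IsCompact ((valuedCongruenceSubgroup (Fin 2) (1 : WithZero (Multiplicative ℤ)) :
      Subgroup (GL (Fin 2) (v.adicCompletion K))) : Set (GL (Fin 2) (v.adicCompletion K))) :=
    isCompact_valuedCongruenceSubgroup 2 K v one_ne_zero le_rfl
  have hsub : ((shellSubgroup (F := v.adicCompletion K) r c hc : Subgroup (GL (Fin 2) (v.adicCompletion K))) :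
      Set (GL (Fin 2) (v.adicCompletion K))) ⊆ (fun k => glDiagonal 2 (v.adicCompletion K) ![t, 1] * k * (glDiagonal 2 (v.adicCompletion K) ![t, 1])⁻¹) ''
        ((valuedCongruenceSubgroup (Fin 2) (1 : WithZero (Multiplicative ℤ)) : Subgroup (GL (Fin 2) (v.adicCompletion K))) :
          Set (GL (Fin 2) (v.adicCompletion K))) := by
    intro g hg
    refine ⟨(glDiagonal 2 (v.adicCompletion K) ![t, 1])⁻¹ * g * glDiagonal 2 (v.adicCompletion K) ![t, 1], aInv_mul_mul_a_mem_valuedCongruenceSubgroup_one K v hc htv hg, ?_⟩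
    show glDiagonal 2 (v.adicCompletion K) ![t, 1] * ((glDiagonal 2 (v.adicCompletion K) ![t, 1])⁻¹ * g *
      glDiagonal 2 (v.adicCompletion K) ![t, 1]) * (glDiagonal 2 (v.adicCompletion K) ![t, 1])⁻¹ = g
    group
  exact (hK1.image ((continuous_const.mul continuous_id).mul continuous_const)).of_isClosed_subset
    (Subgroup.isClosed_of_isOpen _ (isOpen_shellSubgroup K v hc)) hsub

/-! ### The local right regular representation and the shell character -/

variable {μ : Measure (AdelicGroupData.gl 2 K).automorphicQuotient} [(AdelicGroupData.gl 2 K).IsAutomorphicMeasure μ]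

variable (μ) in
/-- **The right regular representation of `GL_2(K_v)`** on `L²(GL_2(K) A_G \ GL_2(𝔸_K))`:
`R ∘ ι_v`. [cite: Bump1997, §3.3] -/
def localRightRegular : GL (Fin 2) (v.adicCompletion K) →* ((AdelicGroupData.gl 2 K).L2 μ →L[ℂ] (AdelicGroupData.gl 2 K).L2 μ) :=
  ((AdelicGroupData.gl 2 K).rightRegular μ).toMonoidHom.comp (GLn.toAdelic 2 K v)

/-- Auxiliary. [folklore] -/
theorem localRightRegular_apply (g : GL (Fin 2) (v.adicCompletion K)) (w : (AdelicGroupData.gl 2 K).L2 μ) :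
    localRightRegular K v μ g w = (AdelicGroupData.gl 2 K).rightRegular μ (GLn.toAdelic 2 K v g) w := rfl

/-- **The shell character** `χ_v(j) = ψ_v(j₁₂)` on `GL_2(K_v)` (`ψ_v` the component at `v` of Tate's
character of `𝔸_K`). [cite: Bump1997, §4.4] -/
def shellChar (j : GL (Fin 2) (v.adicCompletion K)) : ℂ :=
  ((((adeleAddChar K).adicComponent v) (ent j 0 1) : Circle) : ℂ)

/-- Auxiliary. [folklore] -/
theorem shellChar_apply (j : GL (Fin 2) (v.adicCompletion K)) :
    shellChar K v j = ((((adeleAddChar K).adicComponent v) (ent j 0 1) : Circle) : ℂ) := rfl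

/-- `|χ_v| = 1`. [folklore] -/
theorem norm_shellChar (j : GL (Fin 2) (v.adicCompletion K)) : ‖shellChar K v j‖ = 1 :=
  Circle.norm_coe _

/-- `χ_v` is continuous. [folklore] -/
theorem continuous_shellChar : Continuous (shellChar K v) := by
  refine continuous_subtype_val.comp ?_
  have hψ : Continuous ((adeleAddChar K).adicComponent v) := by
    have h : Continuous fun x : v.adicCompletion K => adeleAddChar K (adeleSingleHom K v x) :=
      (continuous_adeleAddChar (K := K)).comp (continuous_adeleSingleHom K v)
    exact h
  exact hψ.comp (Units.continuous_val.matrix_elem 0 1)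

variable {K v} in
/-- **Multiplicativity of the shell character on the shell subgroup**, for `ψ_v` trivial on
`𝔭_v^{c-r}`. [folklore] -/
theorem shellChar_mul {r c : ℤ} (hψ : ∀ x : v.adicCompletion K, 𝓋 x ≤ exp (r - c) → (adeleAddChar K).adicComponent v x = 1)
    {j j' : GL (Fin 2) (v.adicCompletion K)} (hj : ShellCond r c j) (hj' : ShellCond r c j') :
    shellChar K v (j * j') = shellChar K v j * shellChar K v j' := by
  rw [shellChar_apply, shellChar_apply, shellChar_apply, ← Circle.coe_mul, ← AddChar.map_add_eq_mul]
  congr 1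
  have e : ent (j * j') 0 1 = (ent (j * j') 0 1 - ent j 0 1 - ent j' 0 1) + (ent j 0 1 + ent j' 0 1) := by ring
  rw [e, AddChar.map_add_eq_mul, hψ _ (valued_mul_entry_sub_le hj hj'), one_mul]

/-! ### The twist datum -/

variable (μ) in
/-- **The shell twist datum**: `(J_{r,c}, R ∘ ι_v, χ_v)` satisfies the hypotheses of
`TwistedSubgroupAverage` when `ψ_v` is trivial on `𝔭_v^{c-r}`. [cite: Bump1997, §4.4] -/
theorem isTwistData_shell {r c : ℤ} (hc : 1 ≤ c)
    (hψ : ∀ x : v.adicCompletion K, 𝓋 x ≤ exp (r - c) → (adeleAddChar K).adicComponent v x = 1) :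
    IsTwistData (shellSubgroup (F := v.adicCompletion K) r c hc) (localRightRegular K v μ) (shellChar K v) where
  norm_rep g w := (AdelicGroupData.gl 2 K).norm_rightRegular_apply μ (GLn.toAdelic 2 K v g) w
  continuous_rep w := ((AdelicGroupData.isStronglyContinuous_rightRegular_holds (AdelicGroupData.gl 2 K) μ) w).comp
    (GLn.continuous_toAdelic 2 K v)
  mul_char := fun _ hj _ hj' => shellChar_mul hψ hj hj'
  norm_char g _ := norm_shellChar K v g
  continuous_char := (continuous_shellChar K v).comp continuous_subtype_val

/-! ### The level subgroup at `v` -/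

/-- The `v`-component of an element of `GL_2(𝔸_K^∞)`. [folklore] -/
def toLocalFinite : GL (Fin 2) (FiniteAdeleRing (𝓞 K) K) →* GL (Fin 2) (v.adicCompletion K) :=
  (GLn.toLocalAt 2 K v).comp (GLn.ofFinite 2 K)

/-- Auxiliary. [folklore] -/
theorem continuous_toLocalFinite : Continuous (toLocalFinite K v) :=
  (GLn.continuous_toLocalAt 2 K v).comp (GLn.continuous_ofFinite (n := 2) (K := K))

/-- Auxiliary. [folklore] -/
theorem toLocalFinite_apply (u : GL (Fin 2) (FiniteAdeleRing (𝓞 K) K)) :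
    toLocalFinite K v u = GLn.toLocalAt 2 K v (GLn.ofFinite 2 K u) := rfl

/-- **The level subgroup** `U ⊓ K_v(e^{-N})` of `GL_2(𝔸_K^∞)`. [cite: Bump1997, §3.3] -/
def levelInfAt (U : Subgroup (GL (Fin 2) (FiniteAdeleRing (𝓞 K) K))) (N : ℕ) : Subgroup (GL (Fin 2) (FiniteAdeleRing (𝓞 K) K)) :=
  U ⊓ (localCongruenceSubgroup 2 K v N).comap (toLocalFinite K v)

variable {K v}

/-- Auxiliary. [folklore] -/
theorem levelAt_le (U : Subgroup (GL (Fin 2) (FiniteAdeleRing (𝓞 K) K))) (N : ℕ) : levelInfAt K v U N ≤ U := inf_le_left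

/-- Auxiliary. [folklore] -/
theorem mem_levelAt_iff {U : Subgroup (GL (Fin 2) (FiniteAdeleRing (𝓞 K) K))} {N : ℕ} {u : GL (Fin 2) (FiniteAdeleRing (𝓞 K) K)} :
    u ∈ levelInfAt K v U N ↔ u ∈ U ∧ toLocalFinite K v u ∈ localCongruenceSubgroup 2 K v N := Iff.rfl

/-- The level subgroup is open. [folklore] -/
theorem isOpen_levelAt {U : Subgroup (GL (Fin 2) (FiniteAdeleRing (𝓞 K) K))} (hU : IsOpen (U : Set (GL (Fin 2) (FiniteAdeleRing (𝓞 K) K))))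
    (N : ℕ) : IsOpen ((levelInfAt K v U N : Subgroup (GL (Fin 2) (FiniteAdeleRing (𝓞 K) K))) : Set (GL (Fin 2) (FiniteAdeleRing (𝓞 K) K))) :=
  hU.inter ((isOpen_localCongruenceSubgroup 2 K v N).preimage (continuous_toLocalFinite K v))

/-- The level subgroup is compact. [folklore] -/
theorem isCompact_levelAt {U : Subgroup (GL (Fin 2) (FiniteAdeleRing (𝓞 K) K))} (hU : IsCompact (U : Set (GL (Fin 2) (FiniteAdeleRing (𝓞 K) K))))
    (N : ℕ) : IsCompact ((levelInfAt K v U N : Subgroup (GL (Fin 2) (FiniteAdeleRing (𝓞 K) K))) : Set (GL (Fin 2) (FiniteAdeleRing (𝓞 K) K))) := by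
  have hopen : IsOpen (((localCongruenceSubgroup 2 K v N).comap (toLocalFinite K v) : Subgroup (GL (Fin 2) (FiniteAdeleRing (𝓞 K) K))) :
      Set (GL (Fin 2) (FiniteAdeleRing (𝓞 K) K))) :=
    (isOpen_localCongruenceSubgroup 2 K v N).preimage (continuous_toLocalFinite K v)
  exact hU.inter_right (Subgroup.isClosed_of_isOpen _ hopen)

/-- For `N ≥ max(c + r, c, -r, d - ?)`... precisely: if `-N ≤ r`, `c + r ≤ N`, `c ≤ N` then the `v`-component
of `u ∈ U ⊓ K_v(e^{-N})` lies in `J_{r,c}`, and `|(u_v)₁₂| ≤ e^{-N}`. [folklore] -/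
theorem toLocalFinite_mem_of_mem_levelAt {U : Subgroup (GL (Fin 2) (FiniteAdeleRing (𝓞 K) K))} {N : ℕ} {r c : ℤ}
    (h1 : -(N : ℤ) ≤ r) (h2 : c + r ≤ N) (h3 : c ≤ N) {u : GL (Fin 2) (FiniteAdeleRing (𝓞 K) K)} (hu : u ∈ levelInfAt K v U N) :
    ShellCond r c (toLocalFinite K v u) ∧ Valued.v (ent (toLocalFinite K v u) 0 1) ≤ exp (-(N : ℤ)) := by
  refine ⟨shellCond_of_mem_valuedCongruenceSubgroup h1 h2 h3 hu.2, ?_⟩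
  obtain ⟨-, -, h⟩ := hu.2
  have := h 0 1
  rwa [Matrix.sub_apply, Matrix.one_apply_ne (by decide), sub_zero] at this

/-! ### Decomposition of `(1, u)` into its `v`-component and the part away from `v` -/

/-- `(1,u) = s((1,u)) · ι_v(u_v)` with `s((1,u))` trivial at `v`. [folklore] -/
theorem ofFinite_eq_awayFrom_mul_toAdelic (u : GL (Fin 2) (FiniteAdeleRing (𝓞 K) K)) :
    (GLn.ofFinite 2 K u : (AdelicGroupData.gl 2 K).Adelic) =
      GLn.awayFrom 2 K v (GLn.ofFinite 2 K u) * GLn.toAdelic 2 K v (toLocalFinite K v u) :=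
  (GLn.awayFrom_mul_toAdelic (v := v) (GLn.ofFinite 2 K u : (AdelicGroupData.gl 2 K).Adelic)).symm

/-- `ι_v(x)` commutes with the part of `(1,u)` away from `v`. [folklore] -/
theorem toAdelic_mul_awayFrom_ofFinite (x : GL (Fin 2) (v.adicCompletion K)) (u : GL (Fin 2) (FiniteAdeleRing (𝓞 K) K)) :
    GLn.toAdelic 2 K v x * GLn.awayFrom 2 K v (GLn.ofFinite 2 K u) = GLn.awayFrom 2 K v (GLn.ofFinite 2 K u) * GLn.toAdelic 2 K v x :=
  GLn.toAdelic_mul_awayFrom x _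

end Place

/-! ### The local embedding into `GL_2(𝔸_K^∞)` -/

section LocalFinite

variable (K : Type) [Field K] [NumberField K] (v : HeightOneSpectrum (𝓞 K))

/-- The local embedding `GL_2(K_v) →* GL_2(𝔸_K^∞)` (finite part of `GLn.ofLocal`). [folklore] -/
def ofLocalFinite : GL (Fin 2) (v.adicCompletion K) →* GL (Fin 2) (FiniteAdeleRing (𝓞 K) K) :=
  (GLn.sndHom 2 K).comp (GLn.ofLocal 2 K v)

/-- `(1, ι_v^∞(g)) = ι_v(g)`. [folklore] -/
theorem ofFinite_ofLocalFinite (g : GL (Fin 2) (v.adicCompletion K)) :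
    GLn.ofFinite 2 K (ofLocalFinite K v g) = GLn.ofLocal 2 K v g := by
  refine GLn.ext_of_fstHom_of_sndHom ?_ ?_
  · rw [GLn.fstHom_ofFinite]
    refine Matrix.GeneralLinearGroup.ext fun i j => ?_
    rw [Units.val_one]
    exact (GLn.fst_coe_ofLocal_apply g i j).symm
  · rw [GLn.sndHom_ofFinite]; rfl

/-- Auxiliary. [folklore] -/
theorem continuous_ofLocalFinite : Continuous (ofLocalFinite K v) :=
  (GLn.continuous_sndHom (n := 2) (K := K)).comp (GLn.continuous_toAdelic 2 K v)

/-- Auxiliary. [folklore] -/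
theorem toLocalFinite_ofLocalFinite (g : GL (Fin 2) (v.adicCompletion K)) : toLocalFinite K v (ofLocalFinite K v g) = g := by
  rw [toLocalFinite_apply, ofFinite_ofLocalFinite]
  exact GLn.toLocal_ofLocal g

variable {K v} in
/-- **An open subgroup of `GL_2(𝔸_K^∞)` contains `ι_v^∞(K_v(e^{-N}))` for `N` large.** [folklore] -/
theorem exists_ofLocalFinite_localCongruenceSubgroup_le {U : Subgroup (GL (Fin 2) (FiniteAdeleRing (𝓞 K) K))}
    (hU : IsOpen (U : Set (GL (Fin 2) (FiniteAdeleRing (𝓞 K) K)))) :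
    ∃ N : ℕ, (localCongruenceSubgroup 2 K v N).map (ofLocalFinite K v) ≤ U := by
  have hmem : (ofLocalFinite K v) ⁻¹' (U : Set (GL (Fin 2) (FiniteAdeleRing (𝓞 K) K))) ∈ 𝓝 (1 : GL (Fin 2) (v.adicCompletion K)) :=
    (hU.preimage (continuous_ofLocalFinite K v)).mem_nhds (by simp [U.one_mem])
  obtain ⟨N, hN⟩ := exists_localCongruenceSubgroup_subset (n := 2) (K := K) (v := v) hmem
  refine ⟨N, ?_⟩
  rintro _ ⟨k, hk, rfl⟩
  exact hN hk

end LocalFinite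

end Literature.NumberTheory.Automorphic
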